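import Summits.BirchSwinnertonDyer.Rank1Residual.F1Sign2.JochnowitzSecondDigitAtTwo
import HarnessLib

/-!
# ES-31 kernel — -es g22's glue `exponent_zero_of_toricPeriod_two_mod_four` (VERBATIM) and REF1 §205's kernel certificates K205.1–6′
# for `JochnowitzSecondDigitAtTwo.lean` (typer -ty g18; proofs only, no new `def`)

Sources: `Summits/…/Cruxes/RankOneAtTwoBigImageOddLocal/JochnowitzSecondDigitES31.lean` **1917a30875cd684a** l.239–267 (glue) and `HOME/REF1-data/b205/Probe205v.lean` **633e513349e40497**
l.294–364 (`K205_1`, `K205_1'`, `K205_2`, `K205_3`, `K205_4`, `K205_5`, `K205_6`, `K205_6'`; std axioms): digit invariance under the frame's free normalisations (odd rescaling of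
`φ`, orientation sign), the glue's arithmetic, the torsion-door consequence of ES-31J as typed (`y_K` torsion ∧ `T ≠ 0` ⟹ `4 ∣ T`, census class T 27/27), and
`H¹(C₂, 𝔽₂²_swap) = 0` (engine `λ_P` over `𝔽_{q²}` = typed `LocallyHalvable` over `ℚ_q`).  DELTAS: none in statements or proofs; REF1's lead section comments «K205.x» are re-homed
as the theorems' docstrings (`lint.docstring`).  Nothing here bears on BSD; 23715 not closed.
-/

noncomputable section

open scoped Classical BigOperators

set_option linter.dupNamespace false
set_option autoImplicit false

namespace Summit.BirchSwinnertonDyer.BirchSwinnertonDyer.Theorems.RankOneAtTwoJochnowitz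

open Literature.NumberTheory.EllipticCurves Literature.NumberTheory.EllipticCurves.ModularForms
  Summit.BirchSwinnertonDyer.Rank1Residual.F1Sign2
  Summit.BirchSwinnertonDyer.BirchSwinnertonDyer.Theorems.RankOneAtTwoOneDoor
  WeierstrassCurve
open Summit.BirchSwinnertonDyer.BirchSwinnertonDyer.Theorems.RankOneAtTwoLevelRaising
  (twoDivCubic NontrivialAtTwo LocallyHalvable NotTwiceRat)

/-! ## -es g22's glue (crux file l.239–267, VERBATIM) -/

/-- Elementary glue (the shape in which the crux's first layer R₀ would consume ES-31): on a door where SOME level-raised rational `W'`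
has toric period `≡ 2 (mod 4)`, ES-31J gives exponent `0` for the Heegner point — Heegner NON-divisibility from a rank-`0`, finite,
quaternionic datum.  (The converse supply «such a `W'`, `q` exist at every `Sel₂`-trivial minimal door» = Le Hung–Li level raising mod 2 +
ES-28A + a rank-`0` `2`-converse for `W'` over `K`, is the rest of Zhang's ladder and is NOT asserted here.) -/
theorem exponent_zero_of_toricPeriod_two_mod_four (hJ : JochnowitzSecondDigitAtTwo)
    (W : WeierstrassCurve ℚ) [W.IsElliptic] [W.IsGloballyMinimal] [NeZero (W.conductorNorm ℤ)]
    (W' : WeierstrassCurve ℚ) [W'.IsElliptic] [W'.IsGloballyMinimal] (q : ℕ) [Fact q.Prime]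
    (hCM : ¬ W.HasCM) (hsurj : ∀ n : ℕ, W.HasSurjectiveModNGaloisRep ((2 ^ n : ℕ) : ℤ)) (hT : Odd W.torsionOrder)
    (hc : Odd W.tamagawaProduct) (hr : W.analyticRank = 1)
    (K : Type) [Field K] [NumberField K] (hK : IsImaginaryQuadratic K) (hodd : Odd (NumberField.discr K))
    (h4 : NumberField.discr K < -4) (hcop : Nat.Coprime (NumberField.discr K).natAbs (q * W.conductorNorm ℤ))
    (hH : SatisfiesHeegnerHypothesis (W.conductorNorm ℤ) K)
    (hin : ((Ideal.span {(q : ℤ)}).primesOver (NumberField.RingOfIntegers K)).ncard = 1)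
    (Dt : ModularParametrizationData W (W.conductorNorm ℤ)) (Hd : HeegnerDatum (W.conductorNorm ℤ) (NumberField.discr K))
    (ι : K →+* ℂ) (P : (W.baseChange K).toAffine.Point)
    (hP : WeierstrassCurve.Affine.Point.map ι.toRatAlgHom P = heegnerPointComplex Dt Hd) (hcodd : Odd Dt.c)
    (P₀ : (W.baseChange ℚ).toAffine.Point) (hP₀ : NotTwiceRat W P₀)
    (a b : ℚ) (O : Subring (QuaternionAlgebra ℚ a 0 b)) (RI : Set (Submodule ℤ (QuaternionAlgebra ℚ a 0 b)))
    (φ : Submodule ℤ (QuaternionAlgebra ℚ a 0 b) → ℤ) (hF : DefiniteFrame W W' q a b O RI φ)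
    (ψ : K →ₐ[ℚ] QuaternionAlgebra ℚ a 0 b) (I : Submodule ℤ (QuaternionAlgebra ℚ a 0 b))
    (rep : ClassGroup (NumberField.RingOfIntegers K) → nonZeroDivisors (Ideal (NumberField.RingOfIntegers K)))
    (hx : GrossPoint RI K ψ I rep) (h2 : toricPeriod φ K ψ I rep % 4 = 2) :
    HasTwoDivisibilityUpToTorsion W K P 0 := by
  have hne : toricPeriod φ K ψ I rep ≠ 0 := by
    intro h0; rw [h0] at h2; norm_num at h2
  have h4n : ¬ (4 : ℤ) ∣ toricPeriod φ K ψ I rep := by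
    intro hd; have := Int.emod_emod_of_dvd (toricPeriod φ K ψ I rep) (dvd_refl (4:ℤ)); omega
  exact ((hJ W W' q hCM hsurj hT hc hr K hK hodd h4 hcop hH hin Dt Hd ι P hP hcodd P₀ hP₀ a b O RI φ hF ψ I rep hx hne).mp h4n).1

/-! ## REF1 §205 kernel certificates (Probe205v.lean l.294–364; sorry-free; std axioms; statements and proofs VERBATIM, lead comments re-homed as docstrings) -/

/-- REF1 §205 K205.1 — the digit `¬ 4 ∣ T` is invariant under the frame's free normalisation `φ ↦ k φ`, `k` odd
(`DefiniteFrame` pins `φ` only up to an odd integer multiple: eigenline of dimension one + `∃ J, Odd (φ J)`). -/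
theorem K205_1 (T j : ℤ) : (4 : ℤ) ∣ (2 * j + 1) * T ↔ (4 : ℤ) ∣ T := by
  rcases Int.even_or_odd T with ⟨s, rfl⟩ | ⟨s, rfl⟩
  · have e : (2 * j + 1) * (s + s) = 2 * s + 4 * (j * s) := by ring
    rw [e]; generalize j * s = m; omega
  · have e : (2 * j + 1) * (2 * s + 1) = 2 * (2 * (j * s) + j + s) + 1 := by ring
    rw [e]; generalize j * s = m; omega

/-- K205.1′ — and so is the parity `2 ∣ T` (ES-31E). -/
theorem K205_1' (T j : ℤ) : (2 : ℤ) ∣ (2 * j + 1) * T ↔ (2 : ℤ) ∣ T := by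
  have e : (2 * j + 1) * T = 2 * (j * T) + T := by ring
  rw [e]; generalize j * T = m; omega

/-- REF1 §205 K205.2 — invariance under the orientation sign `T ↦ −T` (Atkin–Lehner: `T(w·x) = ± T(x)`). -/
theorem K205_2 (T : ℤ) : ((4 : ℤ) ∣ -T ↔ (4 : ℤ) ∣ T) ∧ ((2 : ℤ) ∣ -T ↔ (2 : ℤ) ∣ T) ∧ (-T ≠ 0 ↔ T ≠ 0) := by
  refine ⟨dvd_neg, dvd_neg, ?_⟩; simp

/-- REF1 §205 K205.3 — the glue's arithmetic: `T % 4 = 2` is exactly «`T` even, `T ≠ 0`, `4 ∤ T`». -/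
theorem K205_3 (T : ℤ) : T % 4 = 2 ↔ ((2 : ℤ) ∣ T ∧ ¬ (4 : ℤ) ∣ T) := by
  omega

/-- REF1 §205 K205.4 — a TORSION point never has exponent `0` (`HasTwoDivisibilityUpToTorsion W K P 0` is false for `P` torsion):
so at a door where `y_K` is torsion (`L(E^{(d_K)},1) = 0`), ES-31J as typed PREDICTS `4 ∣ T` whenever `T ≠ 0` (census class T: 27/27). -/
theorem K205_4 (W : WeierstrassCurve ℚ) (K : Type) [Field K] [NumberField K]
    (P : (W.baseChange K).toAffine.Point) (hP : P ∈ AddCommGroup.torsion (W.baseChange K).toAffine.Point) :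
    ¬ HasTwoDivisibilityUpToTorsion W K P 0 := by
  rintro ⟨Q, hQ, hnt⟩
  apply hnt
  refine ⟨0, ?_⟩
  rw [pow_zero, one_smul] at hQ
  have hQt : Q ∈ AddCommGroup.torsion (W.baseChange K).toAffine.Point := by
    have h := sub_mem hP hQ
    simpa using h
  simpa using hQt

/-- K205.5 — the torsion-door consequence of ES-31J as typed: `y_K` torsion and `T ≠ 0` force `4 ∣ T`. -/
theorem K205_5 (hJ : JochnowitzSecondDigitAtTwo)
    (W : WeierstrassCurve ℚ) [W.IsElliptic] [W.IsGloballyMinimal] [NeZero (W.conductorNorm ℤ)]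
    (W' : WeierstrassCurve ℚ) [W'.IsElliptic] [W'.IsGloballyMinimal] (q : ℕ) [Fact q.Prime]
    (hCM : ¬ W.HasCM) (hsurj : ∀ n : ℕ, W.HasSurjectiveModNGaloisRep ((2 ^ n : ℕ) : ℤ)) (hT : Odd W.torsionOrder)
    (hc : Odd W.tamagawaProduct) (hr : W.analyticRank = 1)
    (K : Type) [Field K] [NumberField K] (hK : IsImaginaryQuadratic K) (hodd : Odd (NumberField.discr K))
    (h4 : NumberField.discr K < -4) (hcop : Nat.Coprime (NumberField.discr K).natAbs (q * W.conductorNorm ℤ))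
    (hH : SatisfiesHeegnerHypothesis (W.conductorNorm ℤ) K)
    (hin : ((Ideal.span {(q : ℤ)}).primesOver (NumberField.RingOfIntegers K)).ncard = 1)
    (Dt : ModularParametrizationData W (W.conductorNorm ℤ)) (Hd : HeegnerDatum (W.conductorNorm ℤ) (NumberField.discr K))
    (ι : K →+* ℂ) (P : (W.baseChange K).toAffine.Point)
    (hP : WeierstrassCurve.Affine.Point.map ι.toRatAlgHom P = heegnerPointComplex Dt Hd) (hcodd : Odd Dt.c)
    (hPt : P ∈ AddCommGroup.torsion (W.baseChange K).toAffine.Point)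
    (P₀ : (W.baseChange ℚ).toAffine.Point) (hP₀ : NotTwiceRat W P₀)
    (a b : ℚ) (O : Subring (QuaternionAlgebra ℚ a 0 b)) (RI : Set (Submodule ℤ (QuaternionAlgebra ℚ a 0 b)))
    (φ : Submodule ℤ (QuaternionAlgebra ℚ a 0 b) → ℤ) (hF : DefiniteFrame W W' q a b O RI φ)
    (ψ : K →ₐ[ℚ] QuaternionAlgebra ℚ a 0 b) (I : Submodule ℤ (QuaternionAlgebra ℚ a 0 b))
    (rep : ClassGroup (NumberField.RingOfIntegers K) → nonZeroDivisors (Ideal (NumberField.RingOfIntegers K)))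
    (hx : GrossPoint RI K ψ I rep) (hne : toricPeriod φ K ψ I rep ≠ 0) :
    (4 : ℤ) ∣ toricPeriod φ K ψ I rep := by
  by_contra h4n
  exact K205_4 W K P hPt
    ((hJ W W' q hCM hsurj hT hc hr K hK hodd h4 hcop hH hin Dt Hd ι P hP hcodd P₀ hP₀ a b O RI φ hF ψ I rep hx hne).mp h4n).1

/-- REF1 §205 K205.6 — `H¹(C₂, 𝔽₂² with the swap) = 0`: `ker (1 + σ) = im (1 + σ)` on `ZMod 2 × ZMod 2`
(at a transposition prime `q` inert in `K`, `Frob_q` swaps the two non-rational `2`-torsion points, so `E(ℚ_q)/2 ↪ E(K_q)/2`: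
the engine's `λ_P` over `𝔽_{q²}` and the typed `LocallyHalvable W q P₀` over `ℚ_q` are the same bit). -/
theorem K205_6 : ∀ v : ZMod 2 × ZMod 2, v + (v.2, v.1) = 0 → ∃ w : ZMod 2 × ZMod 2, v = w + (w.2, w.1) := by
  decide

/-- K205.6′ — and the swap-invariant LINE of `𝔽₂²` is unique: the only non-zero fixed vector is `(1,1)`
(so a `τ`-stable Lagrangian intersection line inside `E(K_q)/2 ≅ 𝔽₂²` is the image of `E(ℚ_q)/2` — C. Li's obstruction, ES-31E). -/
theorem K205_6' : ∀ v : ZMod 2 × ZMod 2, (v.2, v.1) = v → v ≠ 0 → v = (1, 1) := by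
  decide

end Summit.BirchSwinnertonDyer.BirchSwinnertonDyer.Theorems.RankOneAtTwoJochnowitz
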